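import Literature.AlgebraicGeometry.HodgeTheory.ComplexTorusIntegralHodgeClassesKunnethProjectorsProductBigrading
import Literature.AlgebraicGeometry.HodgeTheory.ComplexTorusIntegralHodgeClassesCorrespondenceExteriorProductDegree
import HarnessLib

/-!
# The Künneth formula for the graded Lefschetz numbers of an exterior product of correspondences

Sequel of g30-#4 (`ComplexTorusIntegralHodgeClassesKunnethProjectorsProductBigrading`: `π_{n,X×X′} ∘ (α × β) = Σ_{s+t=n} (π_{s,X} ∘ α) × (π_{t,X′} ∘ β)`), g30-#6
(`…CorrespondenceExteriorProductDegree`: `(α × β) · (α′ × β′) = (α · α′) × (β · β′)`, `deg(α × β) = deg α · deg β`). Fulton's Lefschetz numbers `∫_{X×X} α · Δ = Σᵢ (−1)ⁱ trace(α^* | HⁱX)` (Example 16.1.15) and their graded pieces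
`deg((π_a ∘ α) · [Δ_X]) = (−1)ᵈ Tr(α^*|Hᵈ(X))` (g29-#9) are MULTIPLICATIVE under the tensor product `α × β` of correspondences (Example 16.1.12) — the Künneth
formula `H•(X × X′) = H•(X) ⊗ H•(X′)` for traces, here for degree-`0` correspondences `α ∈ Hdg^{g_X}(X × X, ℤ)`, `β ∈ Hdg^{g_{X′}}(X′ × X′, ℤ)` of complex tori:

* §1 **`integralHodgeClassesDeg_corrCross_cup_diagonalClass_prod`** — **`deg((α × β) · [Δ_{X×X′}]) = deg(α · [Δ_X]) · deg(β · [Δ_{X′}])`**: the total Lefschetz number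
  `Σ (−1)ⁱ Tr` is multiplicative (`[Δ_{X×X′}] = [Δ_X] × [Δ_{X′}]`, g29-#4; g30-#6);
* §2 **`integralHodgeClassesDeg_corrComp_corrCross_kunnethProjector_cup_diagonalClass_prod`** — **`deg((π_{n,X×X′} ∘ (α × β)) · [Δ_{X×X′}]) = Σ_{s ≤ 2g_X} Σ_{t ≤ 2g_{X′}}
  δ_{n,s+t} · deg((π_{s,X} ∘ α) · [Δ_X]) · deg((π_{t,X′} ∘ β) · [Δ_{X′}])`**: with g29-#9, `(−1)ᵈ Tr((α × β)^* | Hᵈ(X × X′)) = Σ_{d₁+d₂=d} (−1)^{d₁} Tr(α^* | H^{d₁}(X)) ·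
  (−1)^{d₂} Tr(β^* | H^{d₂}(X′))` — the Künneth formula for graded traces.

Everything is a theorem; no definition, no named fact (D-0026). Frames as in g30-#3/g30-#4 (`eX`, `eXX`, `eX′`, `eX′X′`, `eXX′`, `ePP` with rank bookkeeping; composites
in arbitrary frames `eT`, `eT′`, `eTP`).

## References
* [Fulton1998] W. Fulton, Intersection Theory, 2nd ed., Springer 1998, §16.1 Example 16.1.15 (p0302 L27–L42), Example 16.1.12 (p0300 L9–L12, p0301 L9), §1.10
  Prop. 1.10 (b) (p0035 L20–L28).
* [Lange2023AbelianVarietiesComplex] H. Lange, Abelian Varieties over the Complex Numbers, Springer 2023, §6.3.4 Prop. 6.3.11 (p0319 L9–L21).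
-/

noncomputable section

open CategoryTheory Function

namespace Literature.AlgebraicGeometry.HodgeTheory

open Literature.AlgebraicGeometry.Motives Literature.AlgebraicGeometry.Motives.HodgeStructure
open Literature.Geometry.Kaehler Literature.Geometry.Kaehler.ComplexTorus

namespace ComplexTorusCat

section Product

variable (X X' : ComplexTorusCat) {gX gX' gXX gX'X' G GP : ℕ} (hG : gX + gX' = G) (hGG : G + G = GP)
  (eX : Fin (2 * gX) ≃ X.toIsog.ι) (eXX : Fin (2 * gXX) ≃ (prodObj X X).toIsog.ι)
  (hX0 : 2 * gX + 2 * 0 = 2 * gX) (hgX : gX + gX = 2 * gX) (hcX : 2 * gX + 2 * gX = 2 * gXX) (hgXX : gXX + gXX = 2 * gXX) (hggX : gX + gX = gXX)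
  (eX' : Fin (2 * gX') ≃ X'.toIsog.ι) (eX'X' : Fin (2 * gX'X') ≃ (prodObj X' X').toIsog.ι)
  (hX'0 : 2 * gX' + 2 * 0 = 2 * gX') (hgX' : gX' + gX' = 2 * gX') (hcX' : 2 * gX' + 2 * gX' = 2 * gX'X') (hgX'X' : gX'X' + gX'X' = 2 * gX'X')
  (hggX' : gX' + gX' = gX'X')
  (eXX' : Fin (2 * G) ≃ (prodObj X X').toIsog.ι) (ePP : Fin (2 * GP) ≃ (prodObj (prodObj X X') (prodObj X X')).toIsog.ι)
  (hP0 : 2 * G + 2 * 0 = 2 * G) (hgP : G + G = 2 * G) (hcP : 2 * G + 2 * G = 2 * GP) (hgPP : GP + GP = 2 * GP)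

/-! ### §1 `deg((α × β) · [Δ_{X×X′}]) = deg(α · [Δ_X]) · deg(β · [Δ_{X′}])` -/

include hG eX eX' hgX hgX' in
/-- **`deg((α × β) · [Δ_{X×X′}]) = deg(α · [Δ_X]) · deg(β · [Δ_{X′}])`** for `α ∈ Hdg^{g_X}(X × X, ℤ)`, `β ∈ Hdg^{g_{X′}}(X′ × X′, ℤ)`: the Lefschetz number `∫ α · Δ = Σ (−1)ⁱ
trace(α^*|Hⁱ)` of Example 16.1.15 is multiplicative for the exterior product of correspondences (`[Δ_{X×X′}] = [Δ_X] × [Δ_{X′}]`, g29-#4; `(α × β) · (α′ × β′) = (α ·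
α′) × (β · β′)` and `deg(u × v) = deg u · deg v`, g30-#6). [cite: Fulton1998, §16.1 Example 16.1.15 (p0302 L27–L42) and Example 16.1.12 (p0300 L9–L12)]
[cite: Fulton1998, §1.10 Prop. 1.10 (b) (p0035 L20–L28)] -/
theorem integralHodgeClassesDeg_corrCross_cup_diagonalClass_prod (α : integralHodgeClasses (prodObj X X).toIsog.Φ gX)
    (β : integralHodgeClasses (prodObj X' X').toIsog.Φ gX') :
    integralHodgeClassesDeg (prodObj (prodObj X X') (prodObj X X')) ePP
        (integralHodgeClassesCup (prodObj (prodObj X X') (prodObj X X')).toIsog.Φ hGG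
          (integralHodgeClassesCup (prodObj (prodObj X X') (prodObj X X')).toIsog.Φ hG
            (integralHodgeClassesPullbackHom
              (liftHom (fstHom (prodObj X X') (prodObj X X') ≫ fstHom X X') (sndHom (prodObj X X') (prodObj X X') ≫ fstHom X X')) gX α)
            (integralHodgeClassesPullbackHom
              (liftHom (fstHom (prodObj X X') (prodObj X X') ≫ sndHom X X') (sndHom (prodObj X X') (prodObj X X') ≫ sndHom X X')) gX' β))
          (integralHodgeClassesPushforward 0 G (diagHom (prodObj X X')) eXX' ePP hP0 hgP hcP hgPP (unitIntegralHodgeClass (prodObj X X')))) =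
      integralHodgeClassesDeg (prodObj X X) eXX
          (integralHodgeClassesCup (prodObj X X).toIsog.Φ hggX α (integralHodgeClassesPushforward 0 gX (diagHom X) eX eXX hX0 hgX hcX hgXX (unitIntegralHodgeClass X))) *
        integralHodgeClassesDeg (prodObj X' X') eX'X'
          (integralHodgeClassesCup (prodObj X' X').toIsog.Φ hggX' β
            (integralHodgeClassesPushforward 0 gX' (diagHom X') eX' eX'X' hX'0 hgX' hcX' hgX'X' (unitIntegralHodgeClass X'))) := by
  rw [integralHodgeClassesPushforward_diagHom_prod_unitIntegralHodgeClass X X' eX eX' eXX' hX0 hgX hX'0 hgX' hP0 hgP hG eX eX' eXX eX'X' eXX' ePP hcX hgXX hcX'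
      hgX'X' hcP hgPP, integralHodgeClassesCup_corrCross_corrCross hG hG hGG hggX hggX' (by omega : gXX + gX'X' = GP),
    integralHodgeClassesDeg_corrCross X X' X X' (by omega : gXX + gX'X' = GP) eXX eX'X' ePP hgPP]

/-! ### §2 `deg((π_{n,X×X′} ∘ (α × β)) · [Δ_{X×X′}]) = Σ_{s+t=n} deg((π_{s,X} ∘ α) · [Δ_X]) · deg((π_{t,X′} ∘ β) · [Δ_{X′}])` -/

variable {nT nT' nTP gT gT' gTP : ℕ} (eT : Fin nT ≃ (prodObj X (prodObj X X)).toIsog.ι) (h3 : 2 * gX + 2 * gXX = nT) (hgT : gT + gT = nT)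
  (eT' : Fin nT' ≃ (prodObj X' (prodObj X' X')).toIsog.ι) (h3b : 2 * gX' + 2 * gX'X' = nT') (hgT' : gT' + gT' = nT')
  (eTP : Fin nTP ≃ (prodObj (prodObj X X') (prodObj (prodObj X X') (prodObj X X'))).toIsog.ι) (H3 : 2 * G + 2 * GP = nTP) (hgTP : gTP + gTP = nTP)

include hG eX eX' hgX hgX' in
/-- **THE KÜNNETH FORMULA FOR GRADED LEFSCHETZ NUMBERS: `deg((π_{n,X×X′} ∘ (α × β)) · [Δ_{X×X′}]) = Σ_{s ≤ 2g_X} Σ_{t ≤ 2g_{X′}} δ_{n,s+t} · deg((π_{s,X} ∘ α) · [Δ_X]) ·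
deg((π_{t,X′} ∘ β) · [Δ_{X′}])`** for `α ∈ Hdg^{g_X}(X × X, ℤ)`, `β ∈ Hdg^{g_{X′}}(X′ × X′, ℤ)` — by g29-#9 (`deg((π_a ∘ α) · [Δ]) = (−1)ᵈ Tr(α^*|Hᵈ)`, `a + d = 2g`) this is
`(−1)ᵈ Tr((α × β)^* | Hᵈ(X × X′)) = Σ_{d₁+d₂=d} (−1)^{d₁} Tr(α^* | H^{d₁}(X)) · (−1)^{d₂} Tr(β^* | H^{d₂}(X′))`, the trace of `(α × β)^* = α^* ⊗ β^*` on `Hᵈ(X × X′) =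
⊕ H^{d₁}(X) ⊗ H^{d₂}(X′)`. Proof: the bigrading `π_{n,X×X′} ∘ (α × β) = Σ_{s+t=n} (π_s ∘ α) × (π_t ∘ β)` (g30-#4), bi-additivity, and §1 termwise.
[cite: Fulton1998, §16.1 Example 16.1.15 (p0302 L27–L42) and Example 16.1.12 (p0301 L9)] [cite: Lange2023AbelianVarietiesComplex, §6.3.4 Prop. 6.3.11 (p0319 L9–L21)] -/
theorem integralHodgeClassesDeg_corrComp_corrCross_kunnethProjector_cup_diagonalClass_prod (α : integralHodgeClasses (prodObj X X).toIsog.Φ gX)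
    (β : integralHodgeClasses (prodObj X' X').toIsog.Φ gX') (n : ℕ) :
    integralHodgeClassesDeg (prodObj (prodObj X X') (prodObj X X')) ePP
        (integralHodgeClassesCup (prodObj (prodObj X X') (prodObj X X')).toIsog.Φ hGG
          (integralHodgeClassesPushforward GP G
            (liftHom (fstHom (prodObj X X') (prodObj (prodObj X X') (prodObj X X')))
              (sndHom (prodObj X X') (prodObj (prodObj X X') (prodObj X X')) ≫ sndHom (prodObj X X') (prodObj X X'))) eTP ePP H3 hgTP hcP hgPP
            (integralHodgeClassesCup (prodObj (prodObj X X') (prodObj (prodObj X X') (prodObj X X'))).toIsog.Φ hGG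
              (integralHodgeClassesPullbackHom
                (liftHom (fstHom (prodObj X X') (prodObj (prodObj X X') (prodObj X X')))
                  (sndHom (prodObj X X') (prodObj (prodObj X X') (prodObj X X')) ≫ fstHom (prodObj X X') (prodObj X X'))) G
                (integralHodgeClassesCup (prodObj (prodObj X X') (prodObj X X')).toIsog.Φ hG
                  (integralHodgeClassesPullbackHom
                    (liftHom (fstHom (prodObj X X') (prodObj X X') ≫ fstHom X X') (sndHom (prodObj X X') (prodObj X X') ≫ fstHom X X')) gX α)
                  (integralHodgeClassesPullbackHom
                    (liftHom (fstHom (prodObj X X') (prodObj X X') ≫ sndHom X X') (sndHom (prodObj X X') (prodObj X X') ≫ sndHom X X')) gX' β)))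
              (integralHodgeClassesPullbackHom (sndHom (prodObj X X') (prodObj (prodObj X X') (prodObj X X'))) G
                (kunnethProjector (prodObj X X') eXX' ePP hP0 hgP hcP hgPP n))))
          (integralHodgeClassesPushforward 0 G (diagHom (prodObj X X')) eXX' ePP hP0 hgP hcP hgPP (unitIntegralHodgeClass (prodObj X X')))) =
      ∑ s ∈ Finset.range (2 * gX + 1), ∑ t ∈ Finset.range (2 * gX' + 1),
        if n = s + t then
          integralHodgeClassesDeg (prodObj X X) eXX
              (integralHodgeClassesCup (prodObj X X).toIsog.Φ hggX
                (integralHodgeClassesPushforward gXX gX (liftHom (fstHom X (prodObj X X)) (sndHom X (prodObj X X) ≫ sndHom X X)) eT eXX h3 hgT hcX hgXX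
                  (integralHodgeClassesCup (prodObj X (prodObj X X)).toIsog.Φ hggX
                    (integralHodgeClassesPullbackHom (liftHom (fstHom X (prodObj X X)) (sndHom X (prodObj X X) ≫ fstHom X X)) gX α)
                    (integralHodgeClassesPullbackHom (sndHom X (prodObj X X)) gX (kunnethProjector X eX eXX hX0 hgX hcX hgXX s))))
                (integralHodgeClassesPushforward 0 gX (diagHom X) eX eXX hX0 hgX hcX hgXX (unitIntegralHodgeClass X))) *
            integralHodgeClassesDeg (prodObj X' X') eX'X'
              (integralHodgeClassesCup (prodObj X' X').toIsog.Φ hggX'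
                (integralHodgeClassesPushforward gX'X' gX' (liftHom (fstHom X' (prodObj X' X')) (sndHom X' (prodObj X' X') ≫ sndHom X' X')) eT' eX'X' h3b hgT' hcX'
                    hgX'X'
                  (integralHodgeClassesCup (prodObj X' (prodObj X' X')).toIsog.Φ hggX'
                    (integralHodgeClassesPullbackHom (liftHom (fstHom X' (prodObj X' X')) (sndHom X' (prodObj X' X') ≫ fstHom X' X')) gX' β)
                    (integralHodgeClassesPullbackHom (sndHom X' (prodObj X' X')) gX' (kunnethProjector X' eX' eX'X' hX'0 hgX' hcX' hgX'X' t))))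
                (integralHodgeClassesPushforward 0 gX' (diagHom X') eX' eX'X' hX'0 hgX' hcX' hgX'X' (unitIntegralHodgeClass X')))
        else 0 := by
  rw [integralHodgeClassesCorrComp_corrCross_kunnethProjector_prod X X' hG eX eXX hX0 hgX hcX hgXX eX' eX'X' hX'0 hgX' hcX' hgX'X' eXX' ePP hP0 hgP hcP hgPP eT eXX
      hggX h3 hgT hcX hgXX eT' eX'X' hggX' h3b hgT' hcX' hgX'X' eTP ePP (show nTP = nT + nT' by omega) (show 2 * GP = 2 * gXX + 2 * gX'X' by omega) hG hGG H3
      hgTP hcP hgPP α β n]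
  simp only [map_sum, AddMonoidHom.finsetSum_apply]
  refine Finset.sum_congr rfl fun s _ ↦ Finset.sum_congr rfl fun t _ ↦ ?_
  split_ifs
  · exact integralHodgeClassesDeg_corrCross_cup_diagonalClass_prod X X' hG hGG eX eXX hX0 hgX hcX hgXX hggX eX' eX'X' hX'0 hgX' hcX' hgX'X' hggX' eXX' ePP hP0 hgP
      hcP hgPP _ _
  · rw [map_zero, AddMonoidHom.zero_apply, map_zero]

end Product

end ComplexTorusCat

end Literature.AlgebraicGeometry.HodgeTheory
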